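import Literature.NumberTheory.Transcendental.RoyCriterion

/-!
# Counting exponents in Roy's parameter window (1)

Roy (2001) proved that Schanuel's conjecture for rank `l` is equivalent to his Conjecture 2
(`Literature.NumberTheory.Transcendental.RoyCriterion l`), a "small value estimate" whose
parameters `(s₀, s₁, t₀, t₁, u)` range over the window
`Literature.NumberTheory.Transcendental.RoyAdmissible`:
`max{1, t₀, 2t₁} < min{s₀, 2s₁}` and `max{s₀, s₁ + t₁} < u < ½ (1 + t₀ + t₁)`.

In the hypothesis of Conjecture 2 the auxiliary polynomial `P_N` has about `N^{t₀+t₁}` integer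
coefficients of height `≤ e^N` and is asked to take values `≤ exp(-N^u)` at about
`N^{s₀} · N^{l·s₁}` (derivative, translate) pairs.  The elementary inequalities below record how
the window sits relative to the pigeonhole count `(#coefficients)·(log height)` versus
`(#conditions)·(precision)`, i.e. `1 + t₀ + t₁` versus `s₀ + l·s₁ + u`:

* `royAdmissible_one_add_lt` : already for one translate direction, `1 + t₀ + t₁ < s₀ + s₁ + u`;
* `royAdmissible_one_add_lt_rank` : hence `1 + t₀ + t₁ < s₀ + l·s₁ + u` for every `l ≥ 1`;
* `royAdmissible_add_lt_one_add` : but `s₀ + u < 1 + t₀ + t₁` — derivatives and precision at a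
  single point never exceed the count; the excess comes from the translates only;
* `royAdmissible_two_mul_lt` : and the excess is mild: `2 (s₀ + s₁ + u) < 3 (1 + t₀ + t₁)`.

These are statements about real numbers only; the counting interpretation (why auxiliary
polynomials as in Conjecture 2 are not supplied by Dirichlet's box principle at a generic point of
`𝔾ₐ × 𝔾ₘ`, while they are supplied on one-parameter analytic subgroups by Waldschmidt's
construction) is heuristic and is discussed in D. Roy, *An arithmetic criterion for the values of
the exponential function*, Acta Arith. 97 (2001), §1, and N. A. V. Nguyen, D. Roy, *A small value
estimate in dimension two involving translations by rational points*, Int. J. Number Theory (2016),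
arXiv:1412.5163, remarks after Corollary 2.
-/

namespace Summit.Schanuel.Schanuel.Theorems

open Literature.NumberTheory.Transcendental

variable {s₀ s₁ t₀ t₁ u : ℝ}

/-- Unpacking of Roy's window (1) into its scalar inequalities. -/
theorem royAdmissible_iff :
    RoyAdmissible s₀ s₁ t₀ t₁ u ↔
      (0 < s₀ ∧ 0 < s₁ ∧ 0 < t₀ ∧ 0 < t₁ ∧ 0 < u) ∧
      (1 < s₀ ∧ t₀ < s₀ ∧ 2 * t₁ < s₀ ∧ 1 < 2 * s₁ ∧ t₀ < 2 * s₁ ∧ 2 * t₁ < 2 * s₁) ∧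
      (s₀ < u ∧ s₁ + t₁ < u ∧ u < (1 + t₀ + t₁) / 2) := by
  constructor
  · rintro ⟨h0, h1, h2, h3, h4, hA, hB, hC⟩
    have hA₁ : max 1 (max t₀ (2 * t₁)) < s₀ := lt_of_lt_of_le hA (min_le_left _ _)
    have hA₂ : max 1 (max t₀ (2 * t₁)) < 2 * s₁ := lt_of_lt_of_le hA (min_le_right _ _)
    have e₁ : (1 : ℝ) ≤ max 1 (max t₀ (2 * t₁)) := le_max_left _ _
    have e₂ : t₀ ≤ max 1 (max t₀ (2 * t₁)) := (le_max_left _ _).trans (le_max_right _ _)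
    have e₃ : 2 * t₁ ≤ max 1 (max t₀ (2 * t₁)) := (le_max_right _ _).trans (le_max_right _ _)
    exact ⟨⟨h0, h1, h2, h3, h4⟩,
      ⟨e₁.trans_lt hA₁, e₂.trans_lt hA₁, e₃.trans_lt hA₁, e₁.trans_lt hA₂, e₂.trans_lt hA₂,
        e₃.trans_lt hA₂⟩,
      ⟨(le_max_left _ _).trans_lt hB, (le_max_right _ _).trans_lt hB, hC⟩⟩
  · rintro ⟨⟨h0, h1, h2, h3, h4⟩, ⟨a1, b1, c1, a2, b2, c2⟩, ⟨d1, d2, e⟩⟩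
    exact ⟨h0, h1, h2, h3, h4, lt_min (max_lt a1 (max_lt b1 c1)) (max_lt a2 (max_lt b2 c2)),
      max_lt d1 d2, e⟩

/-- In Roy's window (1), one translate direction already makes the condition count exceed the
coefficient count: `1 + t₀ + t₁ < s₀ + s₁ + u`. -/
theorem royAdmissible_one_add_lt (h : RoyAdmissible s₀ s₁ t₀ t₁ u) :
    1 + t₀ + t₁ < s₀ + s₁ + u := by
  obtain ⟨-, ⟨h1, h2, -, -, -, h6⟩, ⟨h7, -, -⟩⟩ := royAdmissible_iff.mp h
  linarith

/-- The same with `l ≥ 1` translate directions: `1 + t₀ + t₁ < s₀ + l·s₁ + u`. -/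
theorem royAdmissible_one_add_lt_rank (h : RoyAdmissible s₀ s₁ t₀ t₁ u) {l : ℕ} (hl : 1 ≤ l) :
    1 + t₀ + t₁ < s₀ + (l : ℝ) * s₁ + u := by
  obtain ⟨⟨-, hs₁, -, -, -⟩, -, -⟩ := royAdmissible_iff.mp h
  have h1 : (1 : ℝ) ≤ (l : ℝ) := by exact_mod_cast hl
  have h2 : s₁ ≤ (l : ℝ) * s₁ := by nlinarith
  linarith [royAdmissible_one_add_lt h]

/-- In Roy's window (1), derivatives and precision at a single point stay below the coefficient
count: `s₀ + u < 1 + t₀ + t₁`. -/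
theorem royAdmissible_add_lt_one_add (h : RoyAdmissible s₀ s₁ t₀ t₁ u) :
    s₀ + u < 1 + t₀ + t₁ := by
  obtain ⟨-, -, ⟨h7, -, h9⟩⟩ := royAdmissible_iff.mp h
  linarith

/-- The excess in Roy's window (1) is mild: `2 (s₀ + s₁ + u) < 3 (1 + t₀ + t₁)`. -/
theorem royAdmissible_two_mul_lt (h : RoyAdmissible s₀ s₁ t₀ t₁ u) :
    2 * (s₀ + s₁ + u) < 3 * (1 + t₀ + t₁) := by
  obtain ⟨⟨-, -, -, ht₁, -⟩, -, ⟨h7, h8, h9⟩⟩ := royAdmissible_iff.mp h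
  linarith

/-- Consequences used when reading Conjecture 2: the precision exponent exceeds the log-height
exponent (`1 < u`), translates outnumber the `X₁`-degree (`t₁ < s₁`), derivatives outnumber the
`X₀`-degree (`t₀ < s₀`), and the total degree budget exceeds the log-height (`1 < t₀ + t₁`). -/
theorem royAdmissible_consequences (h : RoyAdmissible s₀ s₁ t₀ t₁ u) :
    1 < u ∧ t₁ < s₁ ∧ t₀ < s₀ ∧ 1 < t₀ + t₁ := by
  obtain ⟨-, ⟨h1, h2, -, -, -, h6⟩, ⟨h7, -, h9⟩⟩ := royAdmissible_iff.mp h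
  refine ⟨by linarith, by linarith, h2, by linarith⟩

/-- Sanity instance: Roy's admissible example `(1.3, 0.7, 1.2, 0.5, 1.32)` has
`1 + t₀ + t₁ = 2.7 < 3.32 = s₀ + s₁ + u` and `s₀ + u = 2.62 < 2.7`. -/
example : (1 + 1.2 + 0.5 : ℝ) < 1.3 + 0.7 + 1.32 ∧ (1.3 + 1.32 : ℝ) < 1 + 1.2 + 0.5 :=
  ⟨royAdmissible_one_add_lt royAdmissible_example,
    royAdmissible_add_lt_one_add royAdmissible_example⟩

end Summit.Schanuel.Schanuel.Theorems
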